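import Mathlib.Analysis.Calculus.Deriv.Abs
import Literature.Geometry.Lorentzian.AFLinearUniqueness
import Literature.Geometry.Lorentzian.DalembertianCompose
import HarnessLib

/-!
# Positivity of solutions of `Δ_h φ = c φ` that are positive off a compact set, for a potential
# `c` of either sign (Schoen–Yau 1979, Lemma 3.3 on the metrics `ds² + t Ric`)

Schoen–Yau, Comm. Math. Phys. 65 (1979), Lemma 3.3 (pp. 71–72) produces the conformal factor
`φ = 1 + v` of the scalar-flat metric `φ⁴ ds²` as the solution of `Δφ = Rφ/8` ((3.22)) with
`v = O(1/r)`, and needs `φ > 0`: *"the Hopf maximum principle implies `φ > 0` on `N`"* (p. 72).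
For `R ≥ 0` this is E. Hopf's minimum principle alone (`HopfPositivity.lean`). In the proof of
Thm. 2 (pp. 72–74) the lemma is applied to the metrics `ds²_t = ds² + t Ric`, whose scalar
curvatures `R_t` have **no sign**; there positivity rests on the smallness hypothesis
`(∫ |R₋|^{3/2})^{2/3} ≤ ε₀` of Lemmas 3.2–3.3 through the Sobolev inequality of Lemma 3.1 — the
same energy argument that gives the trivial kernel in Lemma 3.2 (p. 65: *"we can apply Lemma 3.1
to obtain `∫ ‖Dv‖² ≤ ε₀ c₁ ∫ ‖Dv‖²`"*).

This file proves that step for a potential `c` of either sign on a Riemannian `3`-manifold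
`(X, h)` satisfying the Sobolev inequality `(∫ |ζ|⁶)^{1/3} ≤ c₁ ∫ h⁻¹(dζ, dζ)` for `ζ ∈ C¹_c(X)`:

* `nonneg_of_dalembertian_eq_mul` — if `φ ∈ C²(X)` solves `Δ_h φ = c φ`, `φ ≥ 0` off a compact
  set, and `4 c₁ (∫ c₋^{3/2} dV)^{2/3} < 3`, then `φ ≥ 0` on `X`. *Proof.* With `φ₋ = max(−φ, 0)`
  (compactly supported), the `C¹` functions `u = φ₋³` and `ζ = φ₋²` (written through the `C¹`
  primitive `s ↦ s|s|`, `contDiff_mul_abs`) satisfy `du = −3φ₋² dφ`, `dζ = −2φ₋ dφ`; Green's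
  identity `∫ u Δφ = −∫ h⁻¹(du, dφ)` reads `3 ∫ φ₋² h⁻¹(dφ, dφ) = −∫ c φ₋⁴ ≤ ∫ c₋ ζ²`, and
  Hölder and Sobolev bound the right side by `‖c₋‖_{3/2} c₁ ∫ h⁻¹(dζ, dζ) = 4 c₁ ‖c₋‖_{3/2}
  ∫ φ₋² h⁻¹(dφ, dφ)`; hence `∫ h⁻¹(dζ, dζ) = 0`, `‖ζ‖₆ = 0` and `φ₋ ≡ 0`.
* `pos_of_dalembertian_eq_mul` — if moreover `X` is connected and `φ > 0` off a compact set with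
  nonempty complement, then `φ > 0` on `X`: `Δ_h φ = c φ ≤ c₊ φ` once `φ ≥ 0`, and E. Hopf's
  minimum principle for `−Δ_h + c₊` (`pos_of_dalembertian_le_of_pos_off_isCompact`) applies.

For the conformal factors `φ_t → 1` of `ds²_t` (positive outside a compact set) this is the
positivity asserted by Lemma 3.3, granted `‖(R_t)₋‖_{L^{3/2}} → 0`. All results are proved; no
definitions and no named facts are introduced.

## References

* R. Schoen, S.-T. Yau, *On the proof of the positive mass conjecture in general relativity*,
  Comm. Math. Phys. 65 (1979) 45–76, Lemma 3.1 (p. 63), proof of Lemma 3.2 (p. 65), Lemma 3.3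
  (pp. 71–72), proof of Thm. 2 (pp. 72–74).
* J. López-Gómez, *Linear Second Order Elliptic Operators*, World Scientific 2013, Thm. 1.2.
-/

noncomputable section

open Set Function Filter Metric MeasureTheory Measure TopologicalSpace Bornology Asymptotics Manifold
  Bundle Module
open scoped Topology Manifold ContDiff ENNReal

namespace Literature.Geometry.Lorentzian

/-! ### The `C¹` primitive `s ↦ s|s|` of `2|s|` and the truncations `φ₋²`, `φ₋³` -/

section RealAux

/-- `s ↦ s|s|` has derivative `2|s|` everywhere. [folklore] -/
theorem hasDerivAt_mul_abs (s : ℝ) : HasDerivAt (fun s : ℝ ↦ s * |s|) (2 * |s|) s := by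
  rcases lt_trichotomy s 0 with hs | rfl | hs
  · exact ((hasDerivAt_id' s).fun_mul (hasDerivAt_abs_neg hs)).congr_deriv
      (by rw [abs_of_neg hs]; ring)
  · rw [hasDerivAt_iff_isLittleO_nhds_zero]
    simp only [zero_add, abs_zero, mul_zero, sub_zero, smul_zero]
    refine Asymptotics.isLittleO_iff.2 fun ε hε ↦ ?_
    filter_upwards [Metric.ball_mem_nhds (0 : ℝ) hε] with h hh
    rw [Metric.mem_ball, dist_zero_right, Real.norm_eq_abs] at hh
    rw [Real.norm_eq_abs, Real.norm_eq_abs, abs_mul, abs_abs, mul_comm]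
    exact mul_le_mul_of_nonneg_right hh.le (abs_nonneg _)
  · exact ((hasDerivAt_id' s).fun_mul (hasDerivAt_abs_pos hs)).congr_deriv
      (by rw [abs_of_pos hs]; ring)

/-- `s ↦ s|s|` is of class `C¹`. [folklore] -/
theorem contDiff_mul_abs : ContDiff ℝ 1 (fun s : ℝ ↦ s * |s|) := by
  have hd : deriv (fun s : ℝ ↦ s * |s|) = fun s ↦ 2 * |s| := funext fun s ↦ (hasDerivAt_mul_abs s).deriv
  refine contDiff_one_iff_deriv.2 ⟨fun s ↦ (hasDerivAt_mul_abs s).differentiableAt, ?_⟩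
  rw [hd]
  exact continuous_const.mul continuous_abs

/-- `(s² − s|s|)/2 = (max(−s, 0))²`. [folklore] -/
theorem sq_sub_mul_abs_div_two (s : ℝ) : (s ^ 2 - s * |s|) / 2 = max (-s) 0 ^ 2 := by
  rcases le_total 0 s with hs | hs
  · rw [abs_of_nonneg hs, max_eq_right (neg_nonpos.2 hs)]
    ring
  · rw [abs_of_nonpos hs, max_eq_left (neg_nonneg.2 hs)]
    ring

/-- `s − |s| = −2 max(−s, 0)`. [folklore] -/
theorem sub_abs_eq_neg_two_mul_max (s : ℝ) : s - |s| = -2 * max (-s) 0 := by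
  rcases le_total 0 s with hs | hs
  · rw [abs_of_nonneg hs, max_eq_right (neg_nonpos.2 hs)]
    ring
  · rw [abs_of_nonpos hs, max_eq_left (neg_nonneg.2 hs)]
    ring

/-- `((s·s|s|) − s³)/2 · s = −((s² − s|s|)/2)²` (i.e. `φ₋³ φ = −φ₋⁴`). [folklore] -/
theorem cube_aux_mul_self (s : ℝ) :
    (s * (s * |s|) - s ^ 3) / 2 * s = -((s ^ 2 - s * |s|) / 2) ^ 2 := by
  rcases le_total 0 s with hs | hs
  · rw [abs_of_nonneg hs]
    ring
  · rw [abs_of_nonpos hs]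
    ring

/-- `s ↦ (s² − s|s|)/2 = (max(−s,0))²` has derivative `s − |s|`. [folklore] -/
theorem hasDerivAt_sq_sub_mul_abs_div_two (s : ℝ) :
    HasDerivAt (fun s : ℝ ↦ (s ^ 2 - s * |s|) / 2) (s - |s|) s :=
  (((hasDerivAt_pow 2 s).fun_sub (hasDerivAt_mul_abs s)).div_const 2).congr_deriv (by
    push_cast
    ring)

/-- `s ↦ ((s·s|s|) − s³)/2 = (max(−s,0))³` has derivative `−3 (max(−s,0))²`. [folklore] -/
theorem hasDerivAt_cube_aux (s : ℝ) :
    HasDerivAt (fun s : ℝ ↦ (s * (s * |s|) - s ^ 3) / 2) (-3 * ((s ^ 2 - s * |s|) / 2)) s :=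
  ((((hasDerivAt_id' s).fun_mul (hasDerivAt_mul_abs s)).fun_sub (hasDerivAt_pow 3 s)).div_const
    2).congr_deriv (by
    rcases le_total 0 s with hs | hs
    · rw [abs_of_nonneg hs]
      push_cast
      ring
    · rw [abs_of_nonpos hs]
      push_cast
      ring)

/-- `s ↦ (s² − s|s|)/2` is `C¹`. [folklore] -/
theorem contDiff_sq_sub_mul_abs_div_two : ContDiff ℝ 1 (fun s : ℝ ↦ (s ^ 2 - s * |s|) / 2) :=
  ((contDiff_id.pow 2).sub contDiff_mul_abs).div_const 2

/-- `s ↦ ((s·s|s|) − s³)/2` is `C¹`. [folklore] -/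
theorem contDiff_cube_aux : ContDiff ℝ 1 (fun s : ℝ ↦ (s * (s * |s|) - s ^ 3) / 2) :=
  ((contDiff_id.mul contDiff_mul_abs).sub (contDiff_id.pow 3)).div_const 2

end RealAux

/-! ### Nonnegativity from the Sobolev inequality, positivity from E. Hopf's principle -/

section Positivity

variable {X : Type} [TopologicalSpace X] [ChartedSpace E3 X] [IsManifold (𝓡 3) ∞ X]
  [T2Space X] [LocallyCompactSpace X] [SigmaCompactSpace X] [MeasurableSpace X] [BorelSpace X]
  (D : InitialDataSet (𝓡 3) X) [D.metric.HasLeviCivita]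

/-- **Nonnegativity of solutions of `Δ_h φ = c φ` that are nonnegative off a compact set, for a
small negative part of `c`** (the energy argument of Schoen–Yau 1979, Lemmas 3.1–3.3, for a
potential of either sign). Let `(X, h)` be a Riemannian `3`-manifold carrying data `(h, k)` and
satisfying the Sobolev inequality `(∫ |ζ|⁶ dV)^{1/3} ≤ c₁ ∫ h⁻¹(dζ, dζ) dV` for `ζ ∈ C¹_c(X)`; let
`c` be continuous with `∫ c₋^{3/2} dV < ∞` and `4 c₁ (∫ c₋^{3/2} dV)^{2/3} < 3`
(`c₋ = max(−c, 0)`); let `φ ∈ C²(X)` solve `Δ_h φ = c φ` and satisfy `φ ≥ 0` off a compact set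
`K`. Then `φ ≥ 0` on `X`. Proof in the module docstring (test function `φ₋³`, Sobolev function
`φ₋²`). [cite: SchoenYauPMT1979, proof of Lemma 3.2 (p. 65) and Lemma 3.3 (pp. 71–72)] -/
theorem nonneg_of_dalembertian_eq_mul {c₁ : ℝ}
    (hS : ∀ ζ : X → ℝ, ContMDiff (𝓡 3) 𝓘(ℝ, ℝ) 1 ζ → HasCompactSupport ζ →
      (∫ x, |ζ x| ^ 6 ∂riemannianMeasure D.h) ^ (1 / 3 : ℝ) ≤
        c₁ * ∫ x, D.metric.innerDual x (mvfderiv (𝓡 3) ζ x).toLinearMap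
          (mvfderiv (𝓡 3) ζ x).toLinearMap ∂riemannianMeasure D.h)
    {c : X → ℝ} (hc : Continuous c)
    (hci : Integrable (fun x ↦ max (-c x) 0 ^ (3 / 2 : ℝ)) (riemannianMeasure D.h))
    (hsmall : 4 * c₁ * (∫ x, max (-c x) 0 ^ (3 / 2 : ℝ) ∂riemannianMeasure D.h) ^ (2 / 3 : ℝ) < 3)
    {φ : X → ℝ} (hφ : ContMDiff (𝓡 3) 𝓘(ℝ, ℝ) 2 φ)
    (hpde : ∀ x, D.metric.dalembertian φ x = c x * φ x)
    {K : Set X} (hK : IsCompact K) (hKφ : ∀ x, x ∉ K → 0 ≤ φ x) :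
    ∀ x, 0 ≤ φ x := by
  classical
  haveI : (PseudoRiemannianMetric.ofRiemannian D.h).HasLeviCivita := ‹D.metric.HasLeviCivita›
  set μ : Measure X := riemannianMeasure D.h with hμ
  haveI : IsFiniteMeasureOnCompacts μ :=
    ⟨fun K hK ↦ riemannianVolume_lt_top_of_isCompact_holds D.h le_rfl hK⟩
  haveI : μ.IsOpenPosMeasure := isOpenPosMeasure_riemannianMeasure D.h
  -- notation
  set ID : (X → ℝ) → (X → ℝ) → X → ℝ := fun ζ ξ x ↦ D.metric.innerDual x
    (mvfderiv (𝓡 3) ζ x).toLinearMap (mvfderiv (𝓡 3) ξ x).toLinearMap with hID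
  have hID0 : ∀ ζ x, 0 ≤ ID ζ ζ x := fun ζ x ↦ innerDual_self_nonneg D.h x _
  set cm : X → ℝ := fun x ↦ max (-c x) 0 with hcm
  have hcm0 : ∀ x, 0 ≤ cm x := fun x ↦ le_max_right _ _
  have hcmc : Continuous cm := hc.neg.max continuous_const
  set N : ℝ := (∫ x, cm x ^ (3 / 2 : ℝ) ∂μ) ^ (2 / 3 : ℝ) with hN
  have hN0 : 0 ≤ N := Real.rpow_nonneg (integral_nonneg fun x ↦ Real.rpow_nonneg (hcm0 x) _) _
  -- w.l.o.g. `c₁ ≥ 0`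
  set c₀ : ℝ := max c₁ 0 with hc₀
  have hc₀0 : 0 ≤ c₀ := le_max_right _ _
  have hS' : ∀ ζ : X → ℝ, ContMDiff (𝓡 3) 𝓘(ℝ, ℝ) 1 ζ → HasCompactSupport ζ →
      (∫ x, |ζ x| ^ 6 ∂μ) ^ (1 / 3 : ℝ) ≤ c₀ * ∫ x, ID ζ ζ x ∂μ := fun ζ hζ hζc ↦
    (hS ζ hζ hζc).trans (mul_le_mul_of_nonneg_right (le_max_left _ _)
      (integral_nonneg (hID0 ζ)))
  have hsmall' : 4 * c₀ * N < 3 := by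
    rcases le_total 0 c₁ with h | h
    · simp only [hc₀, max_eq_left h]
      exact hsmall
    · simp only [hc₀, max_eq_right h, mul_zero, zero_mul]
      norm_num
  -- `c₋ ∈ L^{3/2}`
  have hcmLp : MemLp cm (ENNReal.ofReal (3 / 2)) μ := by
    refine (integrable_norm_rpow_iff (μ := μ) hcmc.aestronglyMeasurable
      (p := ENNReal.ofReal (3 / 2)) (by simp) (by simp)).1 ?_
    rw [ENNReal.toReal_ofReal (by norm_num : (0 : ℝ) ≤ 3 / 2)]
    refine hci.congr (Eventually.of_forall fun x ↦ ?_)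
    change max (-c x) 0 ^ (3 / 2 : ℝ) = ‖cm x‖ ^ (3 / 2 : ℝ)
    rw [Real.norm_eq_abs, abs_of_nonneg (hcm0 x)]
  have hpq : (3 / 2 : ℝ).HolderConjugate 3 := Real.holderConjugate_iff.2 ⟨by norm_num, by norm_num⟩
  -- the truncations `ζ = φ₋²`, `u = φ₋³` through the `C¹` profiles
  have hφ1 : ContMDiff (𝓡 3) 𝓘(ℝ, ℝ) 1 φ := hφ.of_le (by norm_num)
  have hφc : Continuous φ := hφ.continuous
  set η₂ : ℝ → ℝ := fun s ↦ (s ^ 2 - s * |s|) / 2 with hη₂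
  set η₃ : ℝ → ℝ := fun s ↦ (s * (s * |s|) - s ^ 3) / 2 with hη₃
  set ζ : X → ℝ := fun x ↦ η₂ (φ x) with hζ
  set u : X → ℝ := fun x ↦ η₃ (φ x) with hu
  have hζ1 : ContMDiff (𝓡 3) 𝓘(ℝ, ℝ) 1 ζ := contDiff_sq_sub_mul_abs_div_two.comp_contMDiff hφ1
  have hu1 : ContMDiff (𝓡 3) 𝓘(ℝ, ℝ) 1 u := contDiff_cube_aux.comp_contMDiff hφ1
  have hζc' : Continuous ζ := hζ1.continuous
  have hζeq : ∀ x, ζ x = max (-φ x) 0 ^ 2 := fun x ↦ sq_sub_mul_abs_div_two (φ x)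
  have hζ0 : ∀ x, 0 ≤ ζ x := fun x ↦ by rw [hζeq x]; positivity
  -- supports inside `K`
  have hζK : ∀ x, x ∉ K → ζ x = 0 := fun x hx ↦ by
    rw [hζeq x, max_eq_right (neg_nonpos.2 (hKφ x hx))]
    norm_num
  have huK : ∀ x, x ∉ K → u x = 0 := fun x hx ↦ by
    have h0 := hKφ x hx
    simp only [hu, hη₃, abs_of_nonneg h0]
    ring
  have hζcs : HasCompactSupport ζ := HasCompactSupport.intro hK hζK
  have hucs : HasCompactSupport u := HasCompactSupport.intro hK huK
  -- derivatives: `dζ = (φ − |φ|) dφ`, `du = −3 ζ dφ`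
  have hdζ : ∀ x, mvfderiv (𝓡 3) ζ x = (φ x - |φ x|) • mvfderiv (𝓡 3) φ x := fun x ↦ by
    ext v
    rw [FunLike.coe_smul, Pi.smul_apply, smul_eq_mul,
      ← (hasDerivAt_sq_sub_mul_abs_div_two (φ x)).deriv]
    exact PseudoRiemannianMetric.mvfderiv_real_comp
      (hasDerivAt_sq_sub_mul_abs_div_two (φ x)).differentiableAt
      (hφ1.mdifferentiableAt one_ne_zero) v
  have hdu : ∀ x, mvfderiv (𝓡 3) u x = (-3 * ζ x) • mvfderiv (𝓡 3) φ x := fun x ↦ by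
    ext v
    rw [FunLike.coe_smul, Pi.smul_apply, smul_eq_mul,
      show -3 * ζ x = deriv η₃ (φ x) from by rw [(hasDerivAt_cube_aux (φ x)).deriv]]
    exact PseudoRiemannianMetric.mvfderiv_real_comp (hasDerivAt_cube_aux (φ x)).differentiableAt
      (hφ1.mdifferentiableAt one_ne_zero) v
  -- the Dirichlet integrands
  have hIDζ : ∀ x, ID ζ ζ x = 4 * ζ x * ID φ φ x := fun x ↦ by
    simp only [hID, hdζ x, ContinuousLinearMap.toLinearMap_smul, PseudoRiemannianMetric.innerDual,
      map_smul, LinearMap.smul_apply, smul_eq_mul]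
    have h4 : (φ x - |φ x|) * (φ x - |φ x|) = 4 * ζ x := by
      rw [hζeq x, sub_abs_eq_neg_two_mul_max]
      ring
    rw [← mul_assoc, h4]
  have hIDu : ∀ x, ID u φ x = -3 * ζ x * ID φ φ x := fun x ↦ by
    simp only [hID, hdu x, ContinuousLinearMap.toLinearMap_smul, PseudoRiemannianMetric.innerDual,
      LinearMap.smul_apply, smul_eq_mul]
  -- the energy `J = ∫ ζ h⁻¹(dφ, dφ)`
  set J : ℝ := ∫ x, ζ x * ID φ φ x ∂μ with hJ
  have hJi_cont : Continuous fun x ↦ ζ x * ID φ φ x :=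
    hζc'.mul (continuous_innerDual_mvfderiv D.metric hφ1 hφ1)
  have hJcs : HasCompactSupport fun x ↦ ζ x * ID φ φ x := hζcs.mul_right
  have hJint : Integrable (fun x ↦ ζ x * ID φ φ x) μ := hJi_cont.integrable_of_hasCompactSupport hJcs
  have hJ0 : 0 ≤ J := integral_nonneg fun x ↦ mul_nonneg (hζ0 x) (hID0 φ x)
  -- Green's identity for `u` against `φ`: `∫ u Δφ = −∫ h⁻¹(du, dφ) = 3 J`
  have hGreen0 : ∫ x, u x * D.metric.dalembertian φ x ∂μ = -∫ x, ID u φ x ∂μ :=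
    integral_mul_dalembertian_eq_neg_integral_innerDual_of_hasCompactSupport D.h hu1 hucs hφ
  have hGreen : ∫ x, u x * D.metric.dalembertian φ x ∂μ = 3 * J := by
    rw [hGreen0, ← integral_neg, hJ, ← integral_const_mul]
    refine integral_congr_ae (Eventually.of_forall fun x ↦ ?_)
    change -(ID u φ x) = 3 * (ζ x * ID φ φ x)
    rw [hIDu x]
    ring
  -- the left side: `u Δφ = c φ₋³ φ = −c ζ² ≤ c₋ ζ²`
  have hζ2cs : HasCompactSupport fun x ↦ ζ x ^ 2 := hζcs.comp_left (g := fun t : ℝ ↦ t ^ 2) (by simp)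
  have hi_r : Integrable (fun x ↦ cm x * ζ x ^ 2) μ :=
    (hcmc.mul (hζc'.pow 2)).integrable_of_hasCompactSupport hζ2cs.mul_left
  have hi_l : Integrable (fun x ↦ u x * D.metric.dalembertian φ x) μ :=
    (hu1.continuous.mul (continuous_dalembertian (PseudoRiemannianMetric.ofRiemannian D.h)
      hφ)).integrable_of_hasCompactSupport hucs.mul_right
  have hA : 3 * J ≤ ∫ x, cm x * ζ x ^ 2 ∂μ := by
    rw [← hGreen]
    refine integral_mono hi_l hi_r fun x ↦ ?_
    have hx : u x * D.metric.dalembertian φ x = -c x * ζ x ^ 2 := by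
      rw [hpde x, show u x * (c x * φ x) = c x * (u x * φ x) by ring]
      simp only [hu, hζ, hη₃, hη₂]
      rw [cube_aux_mul_self (φ x)]
      ring
    rw [hx]
    exact mul_le_mul_of_nonneg_right (le_max_left _ _) (sq_nonneg _)
  -- Hölder and Sobolev: `∫ c₋ ζ² ≤ N (∫ ζ⁶)^{1/3} ≤ N c₀ ∫ h⁻¹(dζ, dζ) = 4 N c₀ J`
  have hζ2Lp : MemLp (fun x ↦ ζ x ^ 2) (ENNReal.ofReal 3) μ :=
    (hζc'.pow 2).memLp_of_hasCompactSupport hζ2cs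
  have hζ6 : ∀ x, (ζ x ^ 2) ^ (3 : ℝ) = |ζ x| ^ 6 := fun x ↦ by
    rw [← sq_abs (ζ x), show (3 : ℝ) = ((3 : ℕ) : ℝ) by norm_num, Real.rpow_natCast, ← pow_mul]
  have hHolder : ∫ x, cm x * ζ x ^ 2 ∂μ ≤ N * (∫ x, |ζ x| ^ 6 ∂μ) ^ (1 / 3 : ℝ) := by
    have h := integral_mul_le_Lp_mul_Lq_of_nonneg hpq (Eventually.of_forall hcm0)
      (Eventually.of_forall fun x ↦ sq_nonneg (ζ x)) hcmLp hζ2Lp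
    have hN' : (∫ x, cm x ^ (3 / 2 : ℝ) ∂μ) ^ (1 / (3 / 2) : ℝ) = N := by
      rw [hN]
      norm_num
    rw [hN', integral_congr_ae (Eventually.of_forall hζ6)] at h
    exact h
  have hEζ : ∫ x, ID ζ ζ x ∂μ = 4 * J := by
    rw [hJ, ← integral_const_mul]
    refine integral_congr_ae (Eventually.of_forall fun x ↦ ?_)
    change ID ζ ζ x = 4 * (ζ x * ID φ φ x)
    rw [hIDζ x]
    ring
  have hSob : (∫ x, |ζ x| ^ 6 ∂μ) ^ (1 / 3 : ℝ) ≤ c₀ * (4 * J) := by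
    rw [← hEζ]
    exact hS' ζ hζ1 hζcs
  -- hence `J = 0`
  have hJ0' : J = 0 := by
    have h1 : 3 * J ≤ N * (c₀ * (4 * J)) :=
      hA.trans (hHolder.trans (mul_le_mul_of_nonneg_left hSob hN0))
    nlinarith
  -- hence `‖ζ‖₆ = 0` and `ζ ≡ 0`
  have hI0 : 0 ≤ ∫ x, |ζ x| ^ 6 ∂μ := integral_nonneg fun x ↦ by positivity
  have hI6 : ∫ x, |ζ x| ^ 6 ∂μ = 0 := by
    have hroot : (∫ x, |ζ x| ^ 6 ∂μ) ^ (1 / 3 : ℝ) ≤ 0 := by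
      have := hSob
      rw [hJ0', mul_zero, mul_zero] at this
      exact this
    have hroot0 : (∫ x, |ζ x| ^ 6 ∂μ) ^ (1 / 3 : ℝ) = 0 :=
      le_antisymm hroot (Real.rpow_nonneg hI0 _)
    rcases (Real.rpow_eq_zero hI0 (by norm_num)).1 hroot0 with h
    exact h
  have hζ6cs : HasCompactSupport fun x ↦ |ζ x| ^ 6 :=
    hζcs.comp_left (g := fun t : ℝ ↦ |t| ^ 6) (by simp)
  have hζ6i : Integrable (fun x ↦ |ζ x| ^ 6) μ :=
    ((hζc'.abs).pow 6).integrable_of_hasCompactSupport hζ6cs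
  have hae : (fun x ↦ |ζ x| ^ 6) =ᵐ[μ] 0 :=
    (integral_eq_zero_iff_of_nonneg (fun x ↦ by positivity) hζ6i).1 hI6
  have hzero : (fun x ↦ |ζ x| ^ 6) = 0 :=
    (((hζc'.abs).pow 6).ae_eq_iff_eq μ continuous_const).1 hae
  intro x
  have hx : |ζ x| ^ 6 = 0 := congr_fun hzero x
  have hζx : ζ x = 0 := by simpa using hx
  rw [hζeq x] at hζx
  have hm : max (-φ x) 0 = 0 := pow_eq_zero_iff (n := 2) (by norm_num) |>.1 hζx
  have := le_max_left (-φ x) 0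
  rw [hm] at this
  linarith

/-- **Positivity of solutions of `Δ_h φ = c φ` that are positive off a compact set, for a small
negative part of `c`** (Schoen–Yau 1979, Lemma 3.3 with Lemma 3.2: "`φ > 0` on `N`", in the
form needed for the metrics `ds² + t Ric` of the proof of Thm. 2, whose scalar curvatures have no
sign). Under the hypotheses of `nonneg_of_dalembertian_eq_mul` on a connected `X`, if `φ > 0` off
a compact set `K` with `Kᶜ` nonempty, then `φ > 0` everywhere: `φ ≥ 0` by
`nonneg_of_dalembertian_eq_mul`, so `Δ_h φ = c φ ≤ c₊ φ`, and E. Hopf's minimum principle for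
`−Δ_h + c₊` (`pos_of_dalembertian_le_of_pos_off_isCompact`, `HopfPositivity.lean`) gives
`φ > 0`. [cite: SchoenYauPMT1979, Lemma 3.3 (pp. 71–72) and proof of Thm. 2 (pp. 72–74)] -/
theorem pos_of_dalembertian_eq_mul [ConnectedSpace X] {c₁ : ℝ}
    (hS : ∀ ζ : X → ℝ, ContMDiff (𝓡 3) 𝓘(ℝ, ℝ) 1 ζ → HasCompactSupport ζ →
      (∫ x, |ζ x| ^ 6 ∂riemannianMeasure D.h) ^ (1 / 3 : ℝ) ≤
        c₁ * ∫ x, D.metric.innerDual x (mvfderiv (𝓡 3) ζ x).toLinearMap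
          (mvfderiv (𝓡 3) ζ x).toLinearMap ∂riemannianMeasure D.h)
    {c : X → ℝ} (hc : Continuous c)
    (hci : Integrable (fun x ↦ max (-c x) 0 ^ (3 / 2 : ℝ)) (riemannianMeasure D.h))
    (hsmall : 4 * c₁ * (∫ x, max (-c x) 0 ^ (3 / 2 : ℝ) ∂riemannianMeasure D.h) ^ (2 / 3 : ℝ) < 3)
    {φ : X → ℝ} (hφ : ContMDiff (𝓡 3) 𝓘(ℝ, ℝ) 2 φ)
    (hpde : ∀ x, D.metric.dalembertian φ x = c x * φ x)
    {K : Set X} (hK : IsCompact K) (hKφ : ∀ x, x ∉ K → 0 < φ x) (hne : Kᶜ.Nonempty) :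
    ∀ x, 0 < φ x := by
  have hnonneg : ∀ x, 0 ≤ φ x :=
    nonneg_of_dalembertian_eq_mul D hS hc hci hsmall hφ hpde hK fun x hx ↦ (hKφ x hx).le
  set cp : X → ℝ := fun x ↦ max (c x) 0 with hcp
  have hcpc : Continuous cp := hc.max continuous_const
  have hcp0 : ∀ x, 0 ≤ cp x := fun x ↦ le_max_right _ _
  have hpde' : ∀ x, D.metric.dalembertian φ x ≤ cp x * φ x := fun x ↦ by
    rw [hpde x]
    exact mul_le_mul_of_nonneg_right (le_max_left _ _) (hnonneg x)
  exact PseudoRiemannianMetric.pos_of_dalembertian_le_of_pos_off_isCompact D.metric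
    D.isRiemannian_metric hcpc hcp0 hφ hpde' hK hKφ hne

end Positivity

end Literature.Geometry.Lorentzian

end
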